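import Literature.Geometry.Symplectic.GirouxContactPathNbhd
import HarnessLib

/-!
# Giroux's path of contact forms, VII: the correction form `β = f(r) dθ`

Topic `Literature/Geometry/Symplectic`.  Seventh file of the proof of
`Literature.Geometry.Symplectic.GirouxContactPath` (Etnyre 2006, Prop. 3.5/3.18 with the proof of
Lemma 3.3).  Etnyre's correction term is `R f(r) dθ` with `f = r²` near the binding and `f`
constant off a tube.  Here the global `1`-form **`β = OpenBook.beta ε'`** on `M` is built, for an
open book whose tubes of radius `ε'` are pairwise disjoint:

* on the open `ε'`-tube of the `i`-th binding component, `β = κ(ρ) · λ_i` with `ρ = ‖w‖²`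
  (`OpenBook.rhoN`), `λ_i = x dy - y dx` in the disc coordinate of the tube (`OpenBook.lamTube`)
  and `κ = kappaProfile (ε'/2)` (`κ = 1` near `0`, `κ(ρ) = (ε'/2)²/ρ` for `ρ ≥ (ε'/2)²`);
* elsewhere `β = (ε'/2)² · dθ` (`OpenBook.thetaForm`);

the two descriptions agree on the overlap since `dθ = ρ⁻¹ λ_i` off the binding
(`thetaForm_eq_smul_lamTube`).  Proved here: the two local descriptions (`beta_apply_of_mem`,
`beta_apply_of_not_mem`), smoothness (`isSmoothForm_beta`), `dβ = 0` off the closed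
`ε'/2`-tubes (`mextDeriv_beta_of_not_mem`), and the flat description in the tube coordinates
`(param i)^*β = κ(r²)(x dy - y dx)` (`pullParam_beta_apply`, `mextDeriv_pullParam_beta_apply`).

## References

* J. B. Etnyre, *Lectures on open book decompositions and contact structures* (2006), proof of
  Lemma 3.3. [Etnyre2006]
-/

noncomputable section

open scoped Manifold ContDiff Topology
open Set Function Filter
open Literature.Geometry.Kaehler Literature.Topology.FourManifolds

namespace Literature.Geometry.Symplectic

/-- Local notation: `𝔼 n` is the model Euclidean space `EuclideanSpace ℝ (Fin n)`. -/
local notation "𝔼 " n:arg => EuclideanSpace ℝ (Fin n)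

/-- Local notation: `𝕊 n` is the unit sphere in `EuclideanSpace ℝ (Fin (n + 1))`. -/
local notation "𝕊 " n:arg => (Metric.sphere (0 : EuclideanSpace ℝ (Fin (n + 1))) 1)

attribute [local instance] Literature.Topology.FourManifolds.fact_finrank_euclideanSpace_two

universe u

variable {M : Type u} [TopologicalSpace M] [ChartedSpace (𝔼 3) M] [IsManifold (𝓡 3) ∞ M]

namespace OpenBook

variable (ob : OpenBook M)

open scoped Classical in
/-- **The correction form `β`** (Etnyre's `f(r) dθ`): `κ(ρ) · λ_i` on the open `ε'`-tube of the
`i`-th binding component (`ρ = r²`, `λ_i = x dy - y dx = r² dθ`, `κ = kappaProfile (ε'/2)`), and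
`(ε'/2)² · dθ` elsewhere. [cite: Etnyre2006, proof of Lemma 3.3] -/
def beta (ε' : ℝ) : MForm (𝓡 3) M ℝ 1 := fun y =>
  if h : ∃ i, y ∈ ob.tubeSet i ε' then
    kappaProfile (ε' / 2) (ob.rhoN (Classical.choose h) y) • ob.lamTube (Classical.choose h) y
  else (ε' / 2) ^ 2 • ob.thetaForm y

variable {ob}
variable {ε' : ℝ}

/-- A point of the image of a tube with `rhoN > 0` is off the binding. [folklore] -/
theorem not_mem_binding_of_rhoN_pos {i : Fin ob.k} {y : M} (hy : y ∈ range (ob.tube i))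
    (h : 0 < ob.rhoN i y) : y ∉ ob.binding := by
  obtain ⟨⟨x, w⟩, rfl⟩ := hy
  rw [rhoN_tube] at h
  rw [ob.tube_mem_binding_iff]
  intro hw
  rw [hw, norm_zero] at h
  simp at h

/-- The binding lies in every open tube union: a binding point lies in some `tubeSet i ε`.
[folklore] -/
theorem exists_mem_tubeSet_of_mem_binding {y : M} (hy : y ∈ ob.binding) {ε : ℝ} (hε : 0 < ε) :
    ∃ i, y ∈ ob.tubeSet i ε := by
  obtain ⟨i, x, rfl⟩ := (ob.mem_binding_iff y).1 hy
  exact ⟨i, ob.range_core_subset_tubeSet i hε ⟨x, rfl⟩⟩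

/-- A point outside all closed `ε`-tubes (`ε > 0`) is off the binding. [folklore] -/
theorem not_mem_binding_of_forall_not_mem_tubeSetC {ε : ℝ} (hε : 0 < ε) {y : M}
    (hy : ∀ i, y ∉ ob.tubeSetC i ε) : y ∉ ob.binding := fun hB => by
  obtain ⟨i, hi⟩ := exists_mem_tubeSet_of_mem_binding hB hε
  exact hy i (ob.tubeSet_subset_tubeSetC i _ hi)

/-- **`β` on the `i`-th tube**: `β y = κ(ρ_i(y)) · λ_i(y)` for `y` in the open `ε'`-tube of the
`i`-th component (the tubes being pairwise disjoint). [cite: Etnyre2006, proof of Lemma 3.3] -/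
theorem beta_apply_of_mem (hdisj : Pairwise fun i j => Disjoint (ob.tubeSet i ε') (ob.tubeSet j ε'))
    {i : Fin ob.k} {y : M} (hy : y ∈ ob.tubeSet i ε') :
    ob.beta ε' y = kappaProfile (ε' / 2) (ob.rhoN i y) • ob.lamTube i y := by
  have h : ∃ j, y ∈ ob.tubeSet j ε' := ⟨i, hy⟩
  have hi : Classical.choose h = i := by
    by_contra hne
    exact Set.disjoint_left.1 (hdisj hne) (Classical.choose_spec h) hy
  unfold beta
  rw [dif_pos h, hi]

/-- **`β` off the closed `ε'/2`-tubes**: `β y = (ε'/2)² · dθ(y)` (on the part of an open tube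
beyond radius `ε'/2` one has `κ(ρ) = (ε'/2)²/ρ` and `dθ = ρ⁻¹ λ_i`). [cite: Etnyre2006, proof of Lemma 3.3] -/
theorem beta_apply_of_not_mem [T2Space M] (hε' : 0 < ε')
    (hdisj : Pairwise fun i j => Disjoint (ob.tubeSet i ε') (ob.tubeSet j ε'))
    {y : M} (hy : ∀ i, y ∉ ob.tubeSetC i (ε' / 2)) :
    ob.beta ε' y = (ε' / 2) ^ 2 • ob.thetaForm y := by
  by_cases h : ∃ j, y ∈ ob.tubeSet j ε'
  · obtain ⟨j, hj⟩ := h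
    have hyr : y ∈ range (ob.tube j) := ob.tubeSet_subset_range j ε' hj
    have hρ : (ε' / 2) ^ 2 < ob.rhoN j y :=
      ob.sq_lt_rhoN_of_not_mem_tubeSetC j (by positivity) hyr (hy j)
    have hρ0 : 0 < ob.rhoN j y := lt_of_le_of_lt (by positivity) hρ
    have hyB : y ∉ ob.binding := not_mem_binding_of_rhoN_pos hyr hρ0
    rw [beta_apply_of_mem hdisj hj, kappaProfile_eq_div (half_pos hε') hρ.le,
      ob.thetaForm_eq_smul_lamTube j hyr hyB, smul_smul, div_eq_mul_inv]
  · unfold beta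
    rw [dif_neg h]

/-- The complement of the closed `ε'/2`-tubes is open. [folklore] -/
theorem isOpen_compl_iUnion_tubeSetC [T2Space M] (ε : ℝ) : IsOpen (⋃ i, ob.tubeSetC i ε)ᶜ :=
  (isClosed_iUnion_of_finite fun i => ob.isClosed_tubeSetC i ε).isOpen_compl

/-- **`β = (ε'/2)² dθ` near every point off the closed `ε'/2`-tubes** (germ form).
[cite: Etnyre2006, proof of Lemma 3.3] -/
theorem beta_eventuallyEq_of_not_mem [T2Space M] (hε' : 0 < ε')
    (hdisj : Pairwise fun i j => Disjoint (ob.tubeSet i ε') (ob.tubeSet j ε'))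
    {y : M} (hy : ∀ i, y ∉ ob.tubeSetC i (ε' / 2)) :
    ∀ᶠ w in 𝓝 y, ob.beta ε' w = ((ε' / 2) ^ 2 • ob.thetaForm) w := by
  have hmem : y ∈ (⋃ i, ob.tubeSetC i (ε' / 2))ᶜ := by simpa using hy
  filter_upwards [(ob.isOpen_compl_iUnion_tubeSetC (ε' / 2)).mem_nhds hmem] with w hw
  have hw' : ∀ i, w ∉ ob.tubeSetC i (ε' / 2) := by simpa using hw
  exact beta_apply_of_not_mem hε' hdisj hw'

/-- **`β = κ(ρ_i) λ_i` near every point of the open `i`-th tube** (germ form).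
[cite: Etnyre2006, proof of Lemma 3.3] -/
theorem beta_eventuallyEq_of_mem (hdisj : Pairwise fun i j => Disjoint (ob.tubeSet i ε') (ob.tubeSet j ε'))
    {i : Fin ob.k} {y : M} (hy : y ∈ ob.tubeSet i ε') :
    ∀ᶠ w in 𝓝 y, ((fun z => kappaProfile (ε' / 2) (ob.rhoN i z)) • ob.lamTube i) w = ob.beta ε' w := by
  filter_upwards [(ob.isOpen_tubeSet i ε').mem_nhds hy] with w hw
  exact (beta_apply_of_mem hdisj hw).symm

/-- **`β` is a smooth `1`-form.** [cite: Etnyre2006, proof of Lemma 3.3] -/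
theorem isSmoothForm_beta [T2Space M] (hε' : 0 < ε')
    (hdisj : Pairwise fun i j => Disjoint (ob.tubeSet i ε') (ob.tubeSet j ε')) :
    IsSmoothForm (ob.beta ε') := by
  intro y
  by_cases h : ∃ i, y ∈ ob.tubeSet i ε'
  · obtain ⟨i, hi⟩ := h
    have hyr : y ∈ range (ob.tube i) := ob.tubeSet_subset_range i ε' hi
    have hκ : ContMDiffAt (𝓡 3) 𝓘(ℝ, ℝ) ∞ (fun z => kappaProfile (ε' / 2) (ob.rhoN i z)) y :=
      ((contDiff_kappaProfile (half_pos hε')).contMDiff.contMDiffAt).comp y (ob.contMDiffAt_rhoN i hyr)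
    exact (MForm.SmoothAt.fun_smul hκ (ob.smoothAt_lamTube i hyr)).congr_of_eventuallyEq
      (beta_eventuallyEq_of_mem hdisj hi)
  · have hy : ∀ i, y ∉ ob.tubeSetC i (ε' / 2) := fun i hyi =>
      h ⟨i, ob.tubeSetC_subset_tubeSet i (by linarith) hyi⟩
    have hyB : y ∉ ob.binding := fun hB => h (exists_mem_tubeSet_of_mem_binding hB hε')
    have hs : ((ε' / 2) ^ 2 • ob.thetaForm).SmoothAt y := (ob.smoothAt_thetaForm hyB).smul _
    exact hs.congr_of_eventuallyEq
      ((beta_eventuallyEq_of_not_mem hε' hdisj hy).mono fun w hw => hw.symm)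

/-- **`dβ = 0` off the closed `ε'/2`-tubes** (there `β = c dθ` and `dθ` is closed).
[cite: Etnyre2006, proof of Lemma 3.3] -/
theorem mextDeriv_beta_apply_of_not_mem [T2Space M] (hε' : 0 < ε')
    (hdisj : Pairwise fun i j => Disjoint (ob.tubeSet i ε') (ob.tubeSet j ε'))
    {y : M} (hy : ∀ i, y ∉ ob.tubeSetC i (ε' / 2)) (u v : 𝔼 3) :
    mextDeriv (ob.beta ε') y ![u, v] = 0 := by
  have hyB : y ∉ ob.binding := not_mem_binding_of_forall_not_mem_tubeSetC (half_pos hε') hy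
  rw [mextDeriv_congr_of_eventuallyEq (beta_eventuallyEq_of_not_mem hε' hdisj hy), mextDeriv_smul]
  show (ε' / 2) ^ 2 • mextDeriv ob.thetaForm y ![u, v] = 0
  rw [ob.mextDeriv_thetaForm_apply hyB, smul_zero]

/-- **`dβ = 0` off the closed `ε'/2`-tubes**, as a form. [cite: Etnyre2006, proof of Lemma 3.3] -/
theorem mextDeriv_beta_of_not_mem [T2Space M] (hε' : 0 < ε')
    (hdisj : Pairwise fun i j => Disjoint (ob.tubeSet i ε') (ob.tubeSet j ε'))
    {y : M} (hy : ∀ i, y ∉ ob.tubeSetC i (ε' / 2)) : mextDeriv (ob.beta ε') y = 0 := by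
  ext w
  have hw : w = ![w 0, w 1] := by funext j; fin_cases j <;> rfl
  rw [hw]
  exact mextDeriv_beta_apply_of_not_mem hε' hdisj hy (w 0) (w 1)

/-! ### The flat description of `β` in the coordinates of a tube -/

/-- **`(param i)^*β = κ(r²)(x dy - y dx)`** on the model tube `{‖(x, y)‖ < ε'}`: the values.
[cite: Etnyre2006, proof of Lemma 3.3] -/
theorem pullParam_beta_apply (hdisj : Pairwise fun i j => Disjoint (ob.tubeSet i ε') (ob.tubeSet j ε'))
    (i : Fin ob.k) {p : 𝔼 3} (hp : ‖πw p‖ < ε') (v : Fin 1 → 𝔼 3) :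
    ob.pullParam i (ob.beta ε') p v = bflat (kappaProfile (ε' / 2)) p v := by
  have hmem : ob.param i p ∈ ob.tubeSet i ε' := (ob.param_mem_tubeSet_iff i p ε').2 hp
  have h1 : ob.pullParam i (ob.beta ε') p v =
      ob.beta ε' (ob.param i p) (fun j => mfderiv (𝓡 3) (𝓡 3) (ob.param i) p (v j)) := rfl
  have h2 : (ob.lamTube i).pullback (𝓡 3) (ob.param i) p v =
      ob.lamTube i (ob.param i p) (fun j => mfderiv (𝓡 3) (𝓡 3) (ob.param i) p (v j)) := rfl
  rw [h1, beta_apply_of_mem hdisj hmem, ContinuousAlternatingMap.smul_apply, ← h2,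
    ob.lamTube_pullback_param i, rhoN_param, bflat_apply, lam_apply, smul_eq_mul]

/-- **`(param i)^*β = κ(r²)(x dy - y dx)`** on the model tube, as forms. [cite: Etnyre2006, proof of Lemma 3.3] -/
theorem pullParam_beta_eq (hdisj : Pairwise fun i j => Disjoint (ob.tubeSet i ε') (ob.tubeSet j ε'))
    (i : Fin ob.k) {p : 𝔼 3} (hp : ‖πw p‖ < ε') :
    ob.pullParam i (ob.beta ε') p = bflat (kappaProfile (ε' / 2)) p := by
  ext v
  exact pullParam_beta_apply hdisj i hp v

/-- The model tube `{‖(x, y)‖ < ε'}` is open in `ℝ³`. [folklore] -/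
theorem isOpen_norm_πw_lt (ε : ℝ) : IsOpen {p : 𝔼 3 | ‖πw p‖ < ε} :=
  isOpen_lt (continuous_norm.comp πw.continuous) continuous_const

/-- `(param i)^*β = κ(r²)(x dy - y dx)` near every point of the model tube (germ form).
[folklore] -/
theorem pullParam_beta_eventuallyEq (hdisj : Pairwise fun i j => Disjoint (ob.tubeSet i ε') (ob.tubeSet j ε'))
    (i : Fin ob.k) {p : 𝔼 3} (hp : ‖πw p‖ < ε') :
    ∀ᶠ q in 𝓝 p, ob.pullParam i (ob.beta ε') q = bflat (kappaProfile (ε' / 2)) q := by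
  filter_upwards [(isOpen_norm_πw_lt ε').mem_nhds hp] with q hq
  exact pullParam_beta_eq hdisj i hq

/-- **`d((param i)^*β) = d(κ(r²)(x dy - y dx))`** on the model tube (values), the right-hand
side being the flat exterior derivative `extDeriv (bflatF κ)`. [cite: Etnyre2006, proof of Lemma 3.3] -/
theorem mextDeriv_pullParam_beta_apply
    (hdisj : Pairwise fun i j => Disjoint (ob.tubeSet i ε') (ob.tubeSet j ε'))
    (i : Fin ob.k) {p : 𝔼 3} (hp : ‖πw p‖ < ε') (v : Fin 2 → 𝔼 3) :
    mextDeriv (ob.pullParam i (ob.beta ε')) p v = extDeriv (bflatF (kappaProfile (ε' / 2))) p v := by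
  rw [mextDeriv_congr_of_eventuallyEq (pullParam_beta_eventuallyEq hdisj i hp)]
  exact mextDeriv_toMForm_apply _ p v

end OpenBook

end Literature.Geometry.Symplectic

end
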